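import Summits.CriticalPhenomena.PercolationContinuityZ3.Theorems.PercNearOneGluingNoHeavyLowerTailMajorityGluingZThirteenEightHG1
import Summits.CriticalPhenomena.PercolationContinuityZ3.Theorems.PercNearOneGluingNoHeavyLowerTailMajorityGluingZThirteenEightHG2
import Summits.CriticalPhenomena.PercolationContinuityZ3.Theorems.PercNearOneGluingNoHeavyLowerTailMajorityGluingZThirteenEightHG3
import Summits.CriticalPhenomena.PercolationContinuityZ3.Theorems.PercNearOneGluingNoHeavyLowerTailMajorityGluingZThirteenEightHG4
import Summits.CriticalPhenomena.PercolationContinuityZ3.Theorems.PercNearOneGluingNoHeavyLowerTailMajorityGluingZThirteenEightHR1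
import Summits.CriticalPhenomena.PercolationContinuityZ3.Theorems.PercNearOneGluingNoHeavyLowerTailMajorityGluingZThirteenEightHR2
import Summits.CriticalPhenomena.PercolationContinuityZ3.Theorems.PercNearOneGluingNoHeavyLowerTailMajorityGluingZThirteenEightHR3
import Summits.CriticalPhenomena.PercolationContinuityZ3.Theorems.PercNearOneGluingNoHeavyLowerTailMajorityGluingZThirteenEightHR4
import Summits.CriticalPhenomena.PercolationContinuityZ3.Theorems.PercNearOneGluingNoHeavyLowerTailMajorityGluingZThirteenEightHR5
import Summits.CriticalPhenomena.PercolationContinuityZ3.Theorems.PercNearOneGluingNoHeavyLowerTailMajorityGluingZThirteenEightHR6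
import HarnessLib

/-!
# The degree-3 orbit certificate of the cell `(13,8)` at `c = 11/8`, glued HIERARCHICALLY from 43 spec-only Z parts (4 groups × 6 key ranges) (lane prim-rate, constants-miner 1, gen 39; cert/mkhier.py)

Support file for the closed crux `NoHeavyLowerTail` (stmt-CriticalPhenomena-4575), majority-gluing line.  A SYMMETRISED DEGREE-3 certificate (`…MajorityGluingQCertSym3`) for
«at least 8 of 13 relays cut»: `μ(8 ≤ #cut) ≤ (11/8)·δ` (kit j311929: engine T — the LP in type space — over a cutting-plane pool; exact integer multipliers re-verified in type
space by cert/mksym3z.py: every orbit sum ≥ 0).  43 Z parts (`…ZThirteenEightP*`, cheap checks + fast digests verified part by part); 4 group files (`…ZThirteenEightHG*`: the group's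
aggregate-merge tree equals its 6 key-range chunk literals `…ZThirteenEightHG*C*`); 6 range files (`…ZThirteenEightHR*`: the merged chunks of a key range pass the run check).  Here: `SymCert3.concat`
of the parts' translations, `checkW3S` from `SymCert3Z.checkW3S_concatZ`, and `thirteenEightT2_pos` by LINEAR ASSEMBLY: value of the glued contribution list = Σ parts' digest values
(`SymCert3Z.map_evalC_of_digestsZ2`) = Σ groups' chunk values (`…G*_val`) = Σ ranges' chunk values ≥ 0 (`…R*_nonneg`).  (Why hierarchical: one merge of all 242 643 digest entries
exhausts the kernel, and an aggregated digest literal exceeds the gate's 200 kB file limit.)  No sorries. [cite: VandenbergKahn2001, Thm 1.2 (p. 123)]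
-/

namespace Summit.CriticalPhenomena.PercolationContinuityZ3.Theorems

namespace HubOnly
namespace QCert

/-- The cell parameters `(13,8)`, `c = 11/8`. -/
def thirteenEightT2Base : Cert := ⟨13, 8, 11, 8, 1, [], [], []⟩

/-- The spec parts. -/
def thirteenEightT2Parts : List SymCert3Z := [thirteenEightTP1, thirteenEightTP2, thirteenEightTP3, thirteenEightTP4, thirteenEightTP5, thirteenEightTP6, thirteenEightTP7, thirteenEightTP8, thirteenEightTP9, thirteenEightTP10, thirteenEightTP11, thirteenEightTP12, thirteenEightTP13, thirteenEightTP14, thirteenEightTP15, thirteenEightTP16, thirteenEightTP17, thirteenEightTP18, thirteenEightTP19, thirteenEightTP20, thirteenEightTP21, thirteenEightTP22, thirteenEightTP23, thirteenEightTP24, thirteenEightTP25, thirteenEightTP26, thirteenEightTP27, thirteenEightTP28, thirteenEightTP29, thirteenEightTP30, thirteenEightTP31, thirteenEightTP32, thirteenEightTP33, thirteenEightTP34, thirteenEightTP35, thirteenEightTP36, thirteenEightTP37, thirteenEightTP38, thirteenEightTP39, thirteenEightTP40, thirteenEightTP41, thirteenEightTP42, thirteenEightTP43]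

/-- **The degree-3 orbit certificate of `(13,8)` at `c = 11/8`**: the concatenation of the parts' translations. -/
def thirteenEightT2 : SymCert3 := SymCert3.concat thirteenEightT2Base (List.map SymCert3Z.toS thirteenEightT2Parts)

/-- All parts carry the cell parameters. -/
theorem thirteenEightT2_bases : ∀ d ∈ thirteenEightT2Parts, d.base = thirteenEightT2Base := by
  unfold thirteenEightT2Parts
  intro d hd
  simp only [List.mem_cons, List.mem_nil_iff, or_false] at hd
  rcases hd with rfl | rfl | rfl | rfl | rfl | rfl | rfl | rfl | rfl | rfl | rfl | rfl | rfl | rfl | rfl | rfl | rfl | rfl | rfl | rfl | rfl | rfl | rfl | rfl | rfl | rfl | rfl | rfl | rfl | rfl | rfl | rfl | rfl | rfl | rfl | rfl | rfl | rfl | rfl | rfl | rfl | rfl | rfl <;> rfl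

/-- All parts pass the cheap entry-wise check. -/
theorem thirteenEightT2_wf : ∀ d ∈ thirteenEightT2Parts, d.wfZ = true := by
  unfold thirteenEightT2Parts
  intro d hd
  simp only [List.mem_cons, List.mem_nil_iff, or_false] at hd
  rcases hd with rfl | rfl | rfl | rfl | rfl | rfl | rfl | rfl | rfl | rfl | rfl | rfl | rfl | rfl | rfl | rfl | rfl | rfl | rfl | rfl | rfl | rfl | rfl | rfl | rfl | rfl | rfl | rfl | rfl | rfl | rfl | rfl | rfl | rfl | rfl | rfl | rfl | rfl | rfl | rfl | rfl | rfl | rfl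
  exacts [thirteenEightTP1_wf, thirteenEightTP2_wf, thirteenEightTP3_wf, thirteenEightTP4_wf, thirteenEightTP5_wf, thirteenEightTP6_wf, thirteenEightTP7_wf, thirteenEightTP8_wf, thirteenEightTP9_wf, thirteenEightTP10_wf, thirteenEightTP11_wf, thirteenEightTP12_wf, thirteenEightTP13_wf, thirteenEightTP14_wf, thirteenEightTP15_wf, thirteenEightTP16_wf, thirteenEightTP17_wf, thirteenEightTP18_wf, thirteenEightTP19_wf, thirteenEightTP20_wf, thirteenEightTP21_wf, thirteenEightTP22_wf, thirteenEightTP23_wf, thirteenEightTP24_wf, thirteenEightTP25_wf, thirteenEightTP26_wf, thirteenEightTP27_wf, thirteenEightTP28_wf, thirteenEightTP29_wf, thirteenEightTP30_wf, thirteenEightTP31_wf, thirteenEightTP32_wf, thirteenEightTP33_wf, thirteenEightTP34_wf, thirteenEightTP35_wf, thirteenEightTP36_wf, thirteenEightTP37_wf, thirteenEightTP38_wf, thirteenEightTP39_wf, thirteenEightTP40_wf, thirteenEightTP41_wf, thirteenEightTP42_wf, thirteenEightTP43_wf]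

/-- The base of the glued certificate. -/
theorem thirteenEightT2_base : thirteenEightT2.base = thirteenEightT2Base := SymCert3.concat_base _ _ (SymCert3Z.toS_bases _ _ thirteenEightT2_bases)

/-- Its number of relays. -/
theorem thirteenEightT2_m : thirteenEightT2.base.m = 13 := by
  rw [thirteenEightT2_base]; rfl

/-- The `δ²`-weight of the glued multiplier is positive. -/
theorem thirteenEightT2_DD : 0 < thirteenEightT2.ell2DDS := by
  decide +kernel

/-- **The structure check of the glued certificate.** -/
theorem thirteenEightT2_checkWS : thirteenEightT2.checkW3S = true :=
  SymCert3Z.checkW3S_concatZ thirteenEightT2Base thirteenEightT2Parts thirteenEightT2_bases thirteenEightT2_wf (by decide) (by decide) thirteenEightT2_DD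

/-- The parts' type-space digests. -/
theorem thirteenEightT2_digests : List.Forall₂ (fun d dg => d.digestZ2 24 = dg) thirteenEightT2Parts [thirteenEightTP1D, thirteenEightTP2D, thirteenEightTP3D, thirteenEightTP4D, thirteenEightTP5D, thirteenEightTP6D, thirteenEightTP7D, thirteenEightTP8D, thirteenEightTP9D, thirteenEightTP10D, thirteenEightTP11D, thirteenEightTP12D, thirteenEightTP13D, thirteenEightTP14D, thirteenEightTP15D, thirteenEightTP16D, thirteenEightTP17D, thirteenEightTP18D, thirteenEightTP19D, thirteenEightTP20D, thirteenEightTP21D, thirteenEightTP22D, thirteenEightTP23D, thirteenEightTP24D, thirteenEightTP25D, thirteenEightTP26D, thirteenEightTP27D, thirteenEightTP28D, thirteenEightTP29D, thirteenEightTP30D, thirteenEightTP31D, thirteenEightTP32D, thirteenEightTP33D, thirteenEightTP34D, thirteenEightTP35D, thirteenEightTP36D, thirteenEightTP37D, thirteenEightTP38D, thirteenEightTP39D, thirteenEightTP40D, thirteenEightTP41D, thirteenEightTP42D, thirteenEightTP43D] :=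
  List.Forall₂.cons thirteenEightTP1_digest (List.Forall₂.cons thirteenEightTP2_digest (List.Forall₂.cons thirteenEightTP3_digest (List.Forall₂.cons thirteenEightTP4_digest (List.Forall₂.cons thirteenEightTP5_digest (List.Forall₂.cons thirteenEightTP6_digest (List.Forall₂.cons thirteenEightTP7_digest (List.Forall₂.cons thirteenEightTP8_digest (List.Forall₂.cons thirteenEightTP9_digest (List.Forall₂.cons thirteenEightTP10_digest (List.Forall₂.cons thirteenEightTP11_digest (List.Forall₂.cons thirteenEightTP12_digest (List.Forall₂.cons thirteenEightTP13_digest (List.Forall₂.cons thirteenEightTP14_digest (List.Forall₂.cons thirteenEightTP15_digest (List.Forall₂.cons thirteenEightTP16_digest (List.Forall₂.cons thirteenEightTP17_digest (List.Forall₂.cons thirteenEightTP18_digest (List.Forall₂.cons thirteenEightTP19_digest (List.Forall₂.cons thirteenEightTP20_digest (List.Forall₂.cons thirteenEightTP21_digest (List.Forall₂.cons thirteenEightTP22_digest (List.Forall₂.cons thirteenEightTP23_digest (List.Forall₂.cons thirteenEightTP24_digest (List.Forall₂.cons thirteenEightTP25_digest (List.Forall₂.cons thirteenEightTP26_digest (List.Forall₂.cons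 thirteenEightTP27_digest (List.Forall₂.cons thirteenEightTP28_digest (List.Forall₂.cons thirteenEightTP29_digest (List.Forall₂.cons thirteenEightTP30_digest (List.Forall₂.cons thirteenEightTP31_digest (List.Forall₂.cons thirteenEightTP32_digest (List.Forall₂.cons thirteenEightTP33_digest (List.Forall₂.cons thirteenEightTP34_digest (List.Forall₂.cons thirteenEightTP35_digest (List.Forall₂.cons thirteenEightTP36_digest (List.Forall₂.cons thirteenEightTP37_digest (List.Forall₂.cons thirteenEightTP38_digest (List.Forall₂.cons thirteenEightTP39_digest (List.Forall₂.cons thirteenEightTP40_digest (List.Forall₂.cons thirteenEightTP41_digest (List.Forall₂.cons thirteenEightTP42_digest (List.Forall₂.cons thirteenEightTP43_digest (List.Forall₂.nil)))))))))))))))))))))))))))))))))))))))))))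

set_option maxHeartbeats 4000000 in
/-- **The whole contribution list evaluates nonnegatively at every nonnegative key valuation.** -/
theorem thirteenEightT2_pos : ∀ val : ℕ → ℝ, (∀ key, 0 ≤ val key) → 0 ≤ evalC val thirteenEightT2.contribs3S := by
  intro val hval
  have hg1 := thirteenEightT2G1_val val
  have hg2 := thirteenEightT2G2_val val
  have hg3 := thirteenEightT2G3_val val
  have hg4 := thirteenEightT2G4_val val
  have hr1 := thirteenEightT2R1_nonneg val hval
  have hr2 := thirteenEightT2R2_nonneg val hval
  have hr3 := thirteenEightT2R3_nonneg val hval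
  have hr4 := thirteenEightT2R4_nonneg val hval
  have hr5 := thirteenEightT2R5_nonneg val hval
  have hr6 := thirteenEightT2R6_nonneg val hval
  show 0 ≤ evalC val (SymCert3.concat thirteenEightT2Base (List.map SymCert3Z.toS thirteenEightT2Parts)).contribs3S
  rw [SymCert3.evalC_concat3 thirteenEightT2Base val (List.map SymCert3Z.toS thirteenEightT2Parts) (SymCert3Z.toS_bases _ _ thirteenEightT2_bases),
    SymCert3Z.map_evalC_of_digestsZ2 24 val thirteenEightT2_wf thirteenEightT2_digests]
  rw [evalC_flatten, evalC_flatten] at hg1 hg2 hg3 hg4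
  rw [evalC_flatten] at hr1 hr2 hr3 hr4 hr5 hr6
  simp only [List.map_cons, List.map_nil, List.sum_cons, List.sum_nil] at hg1 hg2 hg3 hg4 hr1 hr2 hr3 hr4 hr5 hr6 ⊢
  linarith

end QCert
end HubOnly

end Summit.CriticalPhenomena.PercolationContinuityZ3.Theorems
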